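import Summits.Ventures.CertifiedManyBodySolver.Observables.TISourcedMinimiserChordFloorExact
import HarnessLib

/-!
# The canonical-class pinning-field response is MONOTONE in the field; typed SECANT and SECOND-DIFFERENCE inequalities between fields;
# transport of floors UP and of ceilings DOWN the field axis

Cell hubbard-floor (D-0160 FLOOR cell FQ1(c) «the secant / second-difference inequalities between certified fields as typed theorems»;
seat hubbard-floor-eng-1 g2, 2026-08-28). The FLOOR-TABLE objects are exact minimisers `ω_h` of the canonical-class sourced energy
`E^{t′}_h(ω) = ω.meanEnergy (hubbardTTPrimeSourcedInteraction 1 t′ U 0 dWaveFormFactor h) 1` over translation-invariant states of density `n`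
(`TISourcedMinimiserChordFloorExact.lean`: they exist at every `n ∈ [0,2)`), and the response `m(ω) = Re ω(P₀^d)`. Since `E_h(ω) = E_0(ω) − 2h·m(ω)`
is AFFINE in `h` for each fixed state (`meanEnergy_hubbardTTPrimeSourced`, `meanEnergy_pairSourceInteraction_dWave_eq`), comparing the two
minimality inequalities at two fields gives, with NO certificate and for every `t′, U, n`:
* §1 **SECANT inequalities** (Griffiths): for minimisers `ω₁` at `h₁` and `ω₂` at `h₂ > h₁`,
  `2(h₂ − h₁)·m(ω₁) ≤ E_{h₁}(ω₁) − E_{h₂}(ω₂) ≤ 2(h₂ − h₁)·m(ω₂)` — the chord slope of the minimal sourced energy between two fields lies between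
  the responses at its ends;
* §2 **MONOTONICITY**: `m(ω₁) ≤ m(ω₂)` (any two minimisers at `h₁ < h₂`; in particular every certified floor at a field is a floor at every larger
  field and every certified ceiling at a field is a ceiling at every smaller field — §4, the «transport» the FLOOR-TABLE had not booked);
* §3 **SECOND DIFFERENCE ≤ 0** (concavity of the minimal sourced energy): for minimisers at `h₁ < h₂ < h₃`,
  `(h₃ − h₂)·(E_{h₁}(ω₁) − E_{h₂}(ω₂)) ≤ (h₂ − h₁)·(E_{h₂}(ω₂) − E_{h₃}(ω₃))`.
These are the exact shape constraints every certified bracket column must respect and the only «secant» statements the data can carry at the kinematic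
scale (a certified NON-POSITIVE secant of `m` itself between two fields would contradict §2: it cannot occur for minimisers). HONEST FRAMING: statements
about infinite-volume ground states of the SOURCED model at fixed density and fixed fields; nothing about `h → 0`, no order parameter, never onset / gap /
Tc / order; superconductivity in the Hubbard model is NOT proved or disproved by any of this. Zero compute; no definition; no named fact; no `sorry`.
References: R. B. Griffiths, Phys. Rev. 152 (1966) 240 §II (convexity/monotonicity of field derivatives); D. Ruelle, *Statistical Mechanics* (1969) §3.4.
-/

noncomputable section

namespace Summit.Ventures.CertifiedManyBodySolver.Observables

open Literature.MathematicalPhysics.QuantumLattice Literature.Probability.LatticeModels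
open InfVolFermionState ThermodynamicLimit Matrix

section MonotoneInField

variable {ω₁ ω₂ ω₃ : InfVolFermionState 2} {t' U n h₁ h₂ h₃ : ℝ}

/-- The canonical-class sourced energy is affine in the field: `E^{t′}_h(ω) = E^{t′}_0-part(ω) − 2h·Re ω(P₀^d)` (μ = 0 pencil).
[cite: KomaTasaki1994, §1] -/
theorem meanEnergy_sourced_eq_sub_two_mul_field (ω : InfVolFermionState 2) (t' U h : ℝ) :
    ω.meanEnergy (hubbardTTPrimeSourcedInteraction 1 t' U 0 dWaveFormFactor h) 1 =
      ω.meanEnergy (hubbardTTPrimeFermionInteraction 1 t' U) 1 -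
        2 * h * (ω.expect (pairRegion (insert 0 unitSteps) 0) (localPairAt (insert 0 unitSteps) dWaveFormFactor 0)).re := by
  rw [meanEnergy_hubbardTTPrimeSourced, meanEnergy_pairSourceInteraction_dWave_eq]
  ring

/-- **SECANT INEQUALITY, lower end (Griffiths).** For translation-invariant density-`n` states `ω₁`, `ω₂` with `ω₂` a minimiser of `E_{h₂}` in that class:
`2(h₂ − h₁)·Re ω₁(P₀^d) ≤ E_{h₁}(ω₁) − E_{h₂}(ω₂)` (any real `h₁, h₂`; uses only the minimality of `ω₂` tested on `ω₁`). [cite: Griffiths1966, §II] -/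
theorem two_mul_sub_mul_re_expect_le_secant (hω₁ : ω₁.IsTranslationInvariant) (hρ₁ : ω₁.density = n)
    (hmin₂ : ∀ ω' : InfVolFermionState 2, ω'.IsTranslationInvariant → ω'.density = n →
      ω₂.meanEnergy (hubbardTTPrimeSourcedInteraction 1 t' U 0 dWaveFormFactor h₂) 1 ≤
        ω'.meanEnergy (hubbardTTPrimeSourcedInteraction 1 t' U 0 dWaveFormFactor h₂) 1) :
    2 * (h₂ - h₁) * (ω₁.expect (pairRegion (insert 0 unitSteps) 0) (localPairAt (insert 0 unitSteps) dWaveFormFactor 0)).re ≤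
      ω₁.meanEnergy (hubbardTTPrimeSourcedInteraction 1 t' U 0 dWaveFormFactor h₁) 1 -
        ω₂.meanEnergy (hubbardTTPrimeSourcedInteraction 1 t' U 0 dWaveFormFactor h₂) 1 := by
  have h := hmin₂ ω₁ hω₁ hρ₁
  rw [meanEnergy_sourced_eq_sub_two_mul_field ω₁ t' U h₂] at h
  rw [meanEnergy_sourced_eq_sub_two_mul_field ω₁ t' U h₁]
  linarith

/-- **SECANT INEQUALITY, upper end (Griffiths).** For translation-invariant density-`n` states `ω₁`, `ω₂` with `ω₁` a minimiser of `E_{h₁}` in that class: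
`E_{h₁}(ω₁) − E_{h₂}(ω₂) ≤ 2(h₂ − h₁)·Re ω₂(P₀^d)` (any real `h₁, h₂`; uses only the minimality of `ω₁` tested on `ω₂`). [cite: Griffiths1966, §II] -/
theorem secant_le_two_mul_sub_mul_re_expect (hω₂ : ω₂.IsTranslationInvariant) (hρ₂ : ω₂.density = n)
    (hmin₁ : ∀ ω' : InfVolFermionState 2, ω'.IsTranslationInvariant → ω'.density = n →
      ω₁.meanEnergy (hubbardTTPrimeSourcedInteraction 1 t' U 0 dWaveFormFactor h₁) 1 ≤
        ω'.meanEnergy (hubbardTTPrimeSourcedInteraction 1 t' U 0 dWaveFormFactor h₁) 1) :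
    ω₁.meanEnergy (hubbardTTPrimeSourcedInteraction 1 t' U 0 dWaveFormFactor h₁) 1 -
        ω₂.meanEnergy (hubbardTTPrimeSourcedInteraction 1 t' U 0 dWaveFormFactor h₂) 1 ≤
      2 * (h₂ - h₁) * (ω₂.expect (pairRegion (insert 0 unitSteps) 0) (localPairAt (insert 0 unitSteps) dWaveFormFactor 0)).re := by
  have h := hmin₁ ω₂ hω₂ hρ₂
  rw [meanEnergy_sourced_eq_sub_two_mul_field ω₂ t' U h₁] at h
  rw [meanEnergy_sourced_eq_sub_two_mul_field ω₂ t' U h₂]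
  linarith

/-- **MONOTONICITY OF THE RESPONSE IN THE FIELD.** For translation-invariant density-`n` states, if `ω₁` minimises `E_{h₁}` and `ω₂` minimises `E_{h₂}`
in that class and `h₁ < h₂`, then `Re ω₁(P₀^d) ≤ Re ω₂(P₀^d)` — ANY two minimisers, no certificate, every `t′, U, n`. [cite: Griffiths1966, §II] -/
theorem re_expect_localPairAt_le_of_minimisers (hlt : h₁ < h₂)
    (hω₁ : ω₁.IsTranslationInvariant) (hρ₁ : ω₁.density = n) (hω₂ : ω₂.IsTranslationInvariant) (hρ₂ : ω₂.density = n)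
    (hmin₁ : ∀ ω' : InfVolFermionState 2, ω'.IsTranslationInvariant → ω'.density = n →
      ω₁.meanEnergy (hubbardTTPrimeSourcedInteraction 1 t' U 0 dWaveFormFactor h₁) 1 ≤
        ω'.meanEnergy (hubbardTTPrimeSourcedInteraction 1 t' U 0 dWaveFormFactor h₁) 1)
    (hmin₂ : ∀ ω' : InfVolFermionState 2, ω'.IsTranslationInvariant → ω'.density = n →
      ω₂.meanEnergy (hubbardTTPrimeSourcedInteraction 1 t' U 0 dWaveFormFactor h₂) 1 ≤
        ω'.meanEnergy (hubbardTTPrimeSourcedInteraction 1 t' U 0 dWaveFormFactor h₂) 1) :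
    (ω₁.expect (pairRegion (insert 0 unitSteps) 0) (localPairAt (insert 0 unitSteps) dWaveFormFactor 0)).re ≤
      (ω₂.expect (pairRegion (insert 0 unitSteps) 0) (localPairAt (insert 0 unitSteps) dWaveFormFactor 0)).re := by
  have hlo := two_mul_sub_mul_re_expect_le_secant (t' := t') (U := U) (h₁ := h₁) hω₁ hρ₁ hmin₂
  have hhi := secant_le_two_mul_sub_mul_re_expect (t' := t') (U := U) (h₂ := h₂) hω₂ hρ₂ hmin₁
  have hpos : 0 < 2 * (h₂ - h₁) := by linarith
  exact le_of_mul_le_mul_left (hlo.trans hhi) hpos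

/-- **SECOND DIFFERENCE ≤ 0 (concavity of the minimal sourced energy across three fields).** For minimisers `ω₁, ω₂, ω₃` at `h₁ < h₂ < h₃`
(translation-invariant, density `n`): `(h₃ − h₂)·(E_{h₁}(ω₁) − E_{h₂}(ω₂)) ≤ (h₂ − h₁)·(E_{h₂}(ω₂) − E_{h₃}(ω₃))`, i.e. the secant slopes of the minimal
sourced energy are ordered through `2·Re ω₂(P₀^d)`. [cite: Griffiths1966, §II] -/
theorem secant_secondDifference_nonpos (h12 : h₁ < h₂) (h23 : h₂ < h₃)
    (hω₂ : ω₂.IsTranslationInvariant) (hρ₂ : ω₂.density = n)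
    (hmin₁ : ∀ ω' : InfVolFermionState 2, ω'.IsTranslationInvariant → ω'.density = n →
      ω₁.meanEnergy (hubbardTTPrimeSourcedInteraction 1 t' U 0 dWaveFormFactor h₁) 1 ≤
        ω'.meanEnergy (hubbardTTPrimeSourcedInteraction 1 t' U 0 dWaveFormFactor h₁) 1)
    (hmin₃ : ∀ ω' : InfVolFermionState 2, ω'.IsTranslationInvariant → ω'.density = n →
      ω₃.meanEnergy (hubbardTTPrimeSourcedInteraction 1 t' U 0 dWaveFormFactor h₃) 1 ≤
        ω'.meanEnergy (hubbardTTPrimeSourcedInteraction 1 t' U 0 dWaveFormFactor h₃) 1) :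
    (h₃ - h₂) * (ω₁.meanEnergy (hubbardTTPrimeSourcedInteraction 1 t' U 0 dWaveFormFactor h₁) 1 -
        ω₂.meanEnergy (hubbardTTPrimeSourcedInteraction 1 t' U 0 dWaveFormFactor h₂) 1) ≤
      (h₂ - h₁) * (ω₂.meanEnergy (hubbardTTPrimeSourcedInteraction 1 t' U 0 dWaveFormFactor h₂) 1 -
        ω₃.meanEnergy (hubbardTTPrimeSourcedInteraction 1 t' U 0 dWaveFormFactor h₃) 1) := by
  -- slope(1,2) ≤ 2 m(ω₂) ≤ slope(2,3)
  have hA := secant_le_two_mul_sub_mul_re_expect (t' := t') (U := U) (h₂ := h₂) hω₂ hρ₂ hmin₁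
  have hB := two_mul_sub_mul_re_expect_le_secant (t' := t') (U := U) (h₁ := h₂) hω₂ hρ₂ hmin₃
  set m₂ := (ω₂.expect (pairRegion (insert 0 unitSteps) 0) (localPairAt (insert 0 unitSteps) dWaveFormFactor 0)).re
  have h1 : 0 < h₂ - h₁ := by linarith
  have h3 : 0 < h₃ - h₂ := by linarith
  nlinarith [mul_le_mul_of_nonneg_left hA h3.le, mul_le_mul_of_nonneg_left hB h1.le]

end MonotoneInField

/-! ## §4  Transport: certified floors move UP the field axis, certified ceilings move DOWN -/

section Transport

variable {t' U n h₁ h₂ c M : ℝ}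

/-- **FLOOR TRANSPORT.** A response floor `c ≤ Re ω(P₀^d)` valid for EVERY translation-invariant density-`n` minimiser of `E_{h₁}` is a floor for every
translation-invariant density-`n` minimiser of `E_{h₂}`, `h₁ < h₂` (`n ∈ [0,2)` so that a minimiser at `h₁` exists). [cite: Griffiths1966, §II] -/
theorem minimiser_floor_transport_up (hlt : h₁ < h₂) (hn0 : 0 ≤ n) (hn2 : n < 2)
    (hfloor : ∀ ω : InfVolFermionState 2, ω.IsTranslationInvariant → ω.density = n →
      (∀ ω' : InfVolFermionState 2, ω'.IsTranslationInvariant → ω'.density = n →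
        ω.meanEnergy (hubbardTTPrimeSourcedInteraction 1 t' U 0 dWaveFormFactor h₁) 1 ≤
          ω'.meanEnergy (hubbardTTPrimeSourcedInteraction 1 t' U 0 dWaveFormFactor h₁) 1) →
      c ≤ (ω.expect (pairRegion (insert 0 unitSteps) 0) (localPairAt (insert 0 unitSteps) dWaveFormFactor 0)).re)
    {ω₂ : InfVolFermionState 2} (hω₂ : ω₂.IsTranslationInvariant) (hρ₂ : ω₂.density = n)
    (hmin₂ : ∀ ω' : InfVolFermionState 2, ω'.IsTranslationInvariant → ω'.density = n →
      ω₂.meanEnergy (hubbardTTPrimeSourcedInteraction 1 t' U 0 dWaveFormFactor h₂) 1 ≤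
        ω'.meanEnergy (hubbardTTPrimeSourcedInteraction 1 t' U 0 dWaveFormFactor h₂) 1) :
    c ≤ (ω₂.expect (pairRegion (insert 0 unitSteps) 0) (localPairAt (insert 0 unitSteps) dWaveFormFactor 0)).re := by
  obtain ⟨ω₁, hω₁, hρ₁, hmin₁⟩ :=
    exists_minimiser_canonicalClass (n := n) (hubbardTTPrimeSourcedInteraction 1 t' U 0 dWaveFormFactor h₁) hn0 hn2
  exact (hfloor ω₁ hω₁ hρ₁ hmin₁).trans (re_expect_localPairAt_le_of_minimisers hlt hω₁ hρ₁ hω₂ hρ₂ hmin₁ hmin₂)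

/-- **CEILING TRANSPORT.** A response ceiling `Re ω(P₀^d) ≤ M` valid for EVERY translation-invariant density-`n` minimiser of `E_{h₂}` is a ceiling for every
translation-invariant density-`n` minimiser of `E_{h₁}`, `h₁ < h₂` (`n ∈ [0,2)`). A ceiling never speaks to presence. [cite: Griffiths1966, §II] -/
theorem minimiser_ceiling_transport_down (hlt : h₁ < h₂) (hn0 : 0 ≤ n) (hn2 : n < 2)
    (hceil : ∀ ω : InfVolFermionState 2, ω.IsTranslationInvariant → ω.density = n →
      (∀ ω' : InfVolFermionState 2, ω'.IsTranslationInvariant → ω'.density = n →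
        ω.meanEnergy (hubbardTTPrimeSourcedInteraction 1 t' U 0 dWaveFormFactor h₂) 1 ≤
          ω'.meanEnergy (hubbardTTPrimeSourcedInteraction 1 t' U 0 dWaveFormFactor h₂) 1) →
      (ω.expect (pairRegion (insert 0 unitSteps) 0) (localPairAt (insert 0 unitSteps) dWaveFormFactor 0)).re ≤ M)
    {ω₁ : InfVolFermionState 2} (hω₁ : ω₁.IsTranslationInvariant) (hρ₁ : ω₁.density = n)
    (hmin₁ : ∀ ω' : InfVolFermionState 2, ω'.IsTranslationInvariant → ω'.density = n →
      ω₁.meanEnergy (hubbardTTPrimeSourcedInteraction 1 t' U 0 dWaveFormFactor h₁) 1 ≤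
        ω'.meanEnergy (hubbardTTPrimeSourcedInteraction 1 t' U 0 dWaveFormFactor h₁) 1) :
    (ω₁.expect (pairRegion (insert 0 unitSteps) 0) (localPairAt (insert 0 unitSteps) dWaveFormFactor 0)).re ≤ M := by
  obtain ⟨ω₂, hω₂, hρ₂, hmin₂⟩ :=
    exists_minimiser_canonicalClass (n := n) (hubbardTTPrimeSourcedInteraction 1 t' U 0 dWaveFormFactor h₂) hn0 hn2
  exact (re_expect_localPairAt_le_of_minimisers hlt hω₁ hρ₁ hω₂ hρ₂ hmin₁ hmin₂).trans (hceil ω₂ hω₂ hρ₂ hmin₂)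

end Transport

end Summit.Ventures.CertifiedManyBodySolver.Observables

end
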